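import Mathlib.NumberTheory.NumberField.Basic
import Mathlib.RingTheory.DedekindDomain.Ideal.Lemmas
import Mathlib.Data.Set.Card
import HarnessLib

/-!
# Finite sets of places above a finite set of places (T-E3g-BUDn, D-n.1 glue)

Cell `b2b-bsdres`, team n1011, seat p10 GEN 4, row T-E3g-BUDn.  Pure bookkeeping between row
T-E3g-BUDn-K's place COUNT (p01: `Nat.card {w : HeightOneSpectrum (𝓞 K') // w.under (𝓞 K) = v}`
for the layers `K' = K_n`) and the witness hypothesis `hwitn` of
`budgetLeLambdaAt_layer_of_tamagawaWitnesses` (a `Finset T₀` of places of `K'` with `b ≤ #T₀` and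
a property at each member): given, for each `v` in a finite set `S` of places of `K`, a lower bound
`c v` for the number of places of `K'` above `v` and a property `P` holding at every place above
every `v ∈ S`, there is a finite set `T₀` of places of `K'` with `∑_{v ∈ S} c v ≤ #T₀` all of whose
members satisfy `P` (`exists_finset_placesOver_card_ge`).  No arithmetic content.
-/

set_option autoImplicit false

open scoped Classical NumberField
open IsDedekindDomain NumberField

namespace Summit.BirchSwinnertonDyer.Rank1Residual.Additive

variable {K K' : Type*} [Field K] [NumberField K] [Field K'] [NumberField K'] [Algebra K K']

/-- There are finitely many places of `K'` above a place `v` of `K` (finitely many primes of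
`𝓞 K'` over `v`, Mathlib `primesOver_finite`). [folklore] -/
theorem finite_placesOver (v : HeightOneSpectrum (𝓞 K)) :
    Finite {w : HeightOneSpectrum (𝓞 K') // w.under (𝓞 K) = v} := by
  haveI : Finite (v.asIdeal.primesOver (𝓞 K')) := (IsDedekindDomain.primesOver_finite v.asIdeal (𝓞 K')).to_subtype
  refine Finite.of_injective (fun w ↦ (⟨w.1.asIdeal, ⟨w.1.isPrime, ⟨?_⟩⟩⟩ : v.asIdeal.primesOver (𝓞 K')))
    fun w w' h ↦ Subtype.ext (HeightOneSpectrum.ext (congrArg (fun P ↦ P.1) h :))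
  have hw := congrArg HeightOneSpectrum.asIdeal w.2
  rw [HeightOneSpectrum.under_asIdeal] at hw
  exact hw.symm

/-- The set of places of `K'` above `v` is finite (set form). [folklore] -/
theorem setOf_under_eq_finite (v : HeightOneSpectrum (𝓞 K)) :
    {w : HeightOneSpectrum (𝓞 K') | w.under (𝓞 K) = v}.Finite :=
  Set.finite_coe_iff.mp (finite_placesOver v)

/-- **From place counts to a finite set of places.** Given a finite set `S` of places of `K`, lower
bounds `c v ≤ #{w ∣ v}` for `v ∈ S`, and a property `P` of places of `K'` holding above every
`v ∈ S`, there is a finite set `T₀` of places of `K'` with `∑_{v ∈ S} c v ≤ #T₀` and `P` on `T₀`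
(take all places above `S`; places above distinct `v` are distinct). [folklore] -/
theorem exists_finset_placesOver_card_ge (S : Finset (HeightOneSpectrum (𝓞 K)))
    (c : HeightOneSpectrum (𝓞 K) → ℕ)
    (hc : ∀ v ∈ S, c v ≤ Nat.card {w : HeightOneSpectrum (𝓞 K') // w.under (𝓞 K) = v})
    (P : HeightOneSpectrum (𝓞 K') → Prop)
    (hP : ∀ v ∈ S, ∀ w : HeightOneSpectrum (𝓞 K'), w.under (𝓞 K) = v → P w) :
    ∃ T₀ : Finset (HeightOneSpectrum (𝓞 K')), ∑ v ∈ S, c v ≤ T₀.card ∧ ∀ w ∈ T₀, P w := by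
  let F : HeightOneSpectrum (𝓞 K) → Finset (HeightOneSpectrum (𝓞 K')) :=
    fun v ↦ (setOf_under_eq_finite (K' := K') v).toFinset
  have hmem : ∀ v w, w ∈ F v ↔ w.under (𝓞 K) = v := fun v w ↦ by
    simp only [F, Set.Finite.mem_toFinset, Set.mem_setOf_eq]
  have hcard : ∀ v, (F v).card = Nat.card {w : HeightOneSpectrum (𝓞 K') // w.under (𝓞 K) = v} :=
    fun v ↦ by
    change (setOf_under_eq_finite (K' := K') v).toFinset.card =
      Nat.card ({w : HeightOneSpectrum (𝓞 K') | w.under (𝓞 K) = v} : Set (HeightOneSpectrum (𝓞 K')))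
    rw [Nat.card_coe_set_eq, Set.ncard_eq_toFinset_card _ (setOf_under_eq_finite (K' := K') v)]
  refine ⟨S.biUnion F, ?_, fun w hw ↦ ?_⟩
  · rw [Finset.card_biUnion]
    · exact Finset.sum_le_sum fun v hv ↦ (hc v hv).trans (hcard v).ge
    · intro v _ v' _ hvv'
      exact Finset.disjoint_left.mpr fun w hw hw' ↦ hvv' (((hmem v w).mp hw).symm.trans
        ((hmem v' w).mp hw'))
  · obtain ⟨v, hv, hwv⟩ := Finset.mem_biUnion.mp hw
    exact hP v hv w ((hmem v w).mp hwv)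

end Summit.BirchSwinnertonDyer.Rank1Residual.Additive
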